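import Mathlib
import Summits.MatrixMultiplication.MatrixMultiplication.Theorems.CondensationDistanceCondensationSound

/-!
# Crux `LongExchangeSound` (stmt-MatrixMultiplication-20136), registered stub `stub_longExchange`

Route `MatrixMultiplication/LongExchangeCondensation` (forward rung over the floor
`Theorems.CondensationSound.CondensationSound_of`).  The rung generalises the ARITY of the exchange move: a
step may derive `P_J` from a pivot `p ∈ J`, an `s`-set `Q ⊆ J − p` and an `(s+1)`-set `U` disjoint from `J`
through the `(s+2)`-term single-pivot Grassmann–Plücker relation
`P_J · P_K = Σ_{u ∈ U} ± P_{J−p+u} · P_{((J∖Q)∪U)−u}`, `K = (J−p−Q) ∪ U`.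

This file proves that identity for the raw maximal minors `P J := φ (det ([1 | Z] ∘ sorted J))` of the
generic `n × (n+m')` matrix `[1 | Z]` (the coordinate system of the floor), with SOME scalars `ε u ∈ ℂ`
(in fact signs) — exactly the registered signature `stub_longExchange` of the birth skeleton.

Proof: the quadratic Plücker relation `det X · det Y = Σ_t det (X[a ↦ Y_t]) · det (Y[t ↦ X_a])`
(`det_mul_det_eq_sum_det_updateCol`, landed with the floor) for `X = M_e`, `Y = M_{e'}` (`e`, `e'` the sorted
enumerations of `J`, `K`; `e a = p`): a summand whose column `e' t` lies in `J − p − Q` has a repeated column and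
vanishes; a summand with `e' t = u ∈ U` is the product of the minors on the injective tuples `e[a ↦ u]` and
`e'[t ↦ p]`, which enumerate `J−p+u` and `((J∖Q)∪U)−u`, hence are `±` the set coordinates (`stub_transport`);
the sum over positions `t` is regrouped over `u = e' t ∈ U` (`Finset.sum_fiberwise_of_maps_to`).
Sources: FallatJohnson2011 §1.2, FominGrigorievKoshevoy2014 (Plücker relations), BurgisserClausenShokrollahi1997.
-/

set_option linter.dupNamespace false

namespace Summit.MatrixMultiplication.MatrixMultiplication.Theorems.LongExchangeSound

open scoped BigOperators Matrix
open Summit.MatrixMultiplication.MatrixMultiplication.Theorems.CondensationSound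
  (det_mul_det_eq_sum_det_updateCol submatrix_updateCol_eq_submatrix_update stub_transport
    update_injective_of_notMem range_update_of_injective card_eq_of_coe_eq_range exists_smul_of_eq_or_eq_neg)

/-- **Quadratic Plücker relation in update form.**  For a matrix `M` with rows `Fin k`, column tuples `e e'` and a
pivot position `a`:  `det M_e · det M_{e'} = Σ_t det M_{e[a ↦ e' t]} · det M_{e'[t ↦ e a]}`. [folklore] -/
theorem det_mul_det_eq_sum_update {R : Type*} [CommRing R] {k : ℕ} {ι : Type*} (M : Matrix (Fin k) ι R)
    (e e' : Fin k → ι) (a : Fin k) :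
    (M.submatrix id e).det * (M.submatrix id e').det =
      ∑ t, (M.submatrix id (Function.update e a (e' t))).det *
        (M.submatrix id (Function.update e' t (e a))).det := by
  rw [det_mul_det_eq_sum_det_updateCol _ _ a]
  refine Finset.sum_congr rfl fun t _ => ?_
  rw [submatrix_updateCol_eq_submatrix_update, submatrix_updateCol_eq_submatrix_update]

/-- A column selection that repeats a column (`e[a ↦ e c]`, `c ≠ a`) has determinant `0`. [folklore] -/
theorem det_submatrix_update_self_eq_zero {R : Type*} [CommRing R] {k : ℕ} {ι : Type*}
    (M : Matrix (Fin k) ι R) (e : Fin k → ι) {a c : Fin k} (hca : c ≠ a) :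
    (M.submatrix id (Function.update e a (e c))).det = 0 := by
  refine Matrix.det_zero_of_column_eq hca fun r => ?_
  simp [Matrix.submatrix_apply, Function.update_of_ne hca]

/-- **STUB `stub_longExchange` — the `(s+2)`-term single-pivot Plücker relation for the raw minors of `[1 | Z]`**
(registered stub of crux stmt-MatrixMultiplication-20136).  For `|J| = n`, `p ∈ J`, `Q ⊆ J − p`, `U ∩ J = ∅`,
`|U| = |Q| + 1` and `K = (J − p − Q) ∪ U`:
`P J · P K = Σ_{u ∈ U} ε_u · P (J − p + u) · P (((J ∖ Q) ∪ U) − u)` for some scalars `ε_u ∈ ℂ`.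
[cite: FallatJohnson2011, §1.2] -/
theorem stub_longExchange :
    ∀ (n m' : ℕ) (P : Finset (Fin (n + m')) → FractionRing (MvPolynomial (Fin n × Fin m') ℂ)),
      (∀ (J : Finset (Fin (n + m'))) (hJ : J.card = n), P J =
        (algebraMap (MvPolynomial (Fin n × Fin m') ℂ) (FractionRing (MvPolynomial (Fin n × Fin m') ℂ)))
          (((Matrix.fromCols (1 : Matrix (Fin n) (Fin n) (MvPolynomial (Fin n × Fin m') ℂ))
            (Matrix.of fun i j => MvPolynomial.X (i, j))).submatrix id ⇑finSumFinEquiv.symm).submatrix id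
              ⇑(J.orderEmbOfFin hJ)).det) →
      ∀ (J Q U : Finset (Fin (n + m'))) (p : Fin (n + m')), J.card = n → p ∈ J → Q ⊆ J.erase p →
        (∀ u ∈ U, u ∉ J) → U.card = Q.card + 1 →
          ∃ ε : Fin (n + m') → ℂ, P J * P ((J.erase p \ Q) ∪ U) =
            ∑ u ∈ U, ε u • (P (insert u (J.erase p)) * P (((J \ Q) ∪ U).erase u)) := by
  intro n m' P hP J Q U p hJ hp hQ hU hUQ
  classical
  -- abbreviations: `φ : ℂ[Z] → ℂ(Z)`, `M = [1 | Z]`, the divisor set `K`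
  set φ := (algebraMap (MvPolynomial (Fin n × Fin m') ℂ) (FractionRing (MvPolynomial (Fin n × Fin m') ℂ))) with hφ
  set M : Matrix (Fin n) (Fin (n + m')) (MvPolynomial (Fin n × Fin m') ℂ) :=
    ((Matrix.fromCols (1 : Matrix (Fin n) (Fin n) (MvPolynomial (Fin n × Fin m') ℂ))
      (Matrix.of fun i j => MvPolynomial.X (i, j))).submatrix id ⇑finSumFinEquiv.symm) with hM
  set K : Finset (Fin (n + m')) := (J.erase p \ Q) ∪ U with hK
  -- elementary facts about `p`, `Q`, `U`, `K`
  have hpQ : p ∉ Q := fun h => by simpa using hQ h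
  have hpU : p ∉ U := fun h => hU p h hp
  have hdisj : Disjoint (J.erase p \ Q) U := by
    rw [Finset.disjoint_left]
    intro x hx hxU
    exact hU x hxU (Finset.mem_of_mem_erase (Finset.mem_sdiff.1 hx).1)
  have hKc : K.card = n := by
    have h1 : (J.erase p \ Q).card = (J.erase p).card - Q.card := Finset.card_sdiff_of_subset hQ
    have h2 : (J.erase p).card = J.card - 1 := Finset.card_erase_of_mem hp
    have h3 : Q.card ≤ (J.erase p).card := Finset.card_le_card hQ
    have h4 : 0 < J.card := Finset.card_pos.mpr ⟨p, hp⟩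
    rw [hK, Finset.card_union_of_disjoint hdisj, h1, h2, hUQ, hJ]
    omega
  have hmemK : ∀ x, x ∈ K ↔ (x ∈ J ∧ x ≠ p ∧ x ∉ Q) ∨ x ∈ U := by
    intro x
    simp only [hK, Finset.mem_union, Finset.mem_sdiff, Finset.mem_erase]
    tauto
  have hpK : p ∉ K := by
    rw [hmemK]
    rintro (⟨-, h, -⟩ | h)
    · exact h rfl
    · exact hpU h
  -- the sorted enumerations of `J` and `K`
  set e : Fin n → Fin (n + m') := ⇑(J.orderEmbOfFin hJ) with he_def
  have he : Function.Injective e := (J.orderEmbOfFin hJ).injective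
  have hre : Set.range e = ↑J := Finset.range_orderEmbOfFin J hJ
  set e' : Fin n → Fin (n + m') := ⇑(K.orderEmbOfFin hKc) with he'_def
  have he' : Function.Injective e' := (K.orderEmbOfFin hKc).injective
  have hre' : Set.range e' = ↑K := Finset.range_orderEmbOfFin K hKc
  obtain ⟨a, ha⟩ : p ∈ Set.range e := by rw [hre]; exact hp
  -- transport: a minor on an injective enumeration of an `n`-set is `±` the set coordinate
  have transport : ∀ (J' : Finset (Fin (n + m'))) (t : Fin n → Fin (n + m')), Function.Injective t →
      (↑J' : Set (Fin (n + m'))) = Set.range t →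
        ∃ ε : ℂ, φ (M.submatrix id t).det = ε • P J' := by
    intro J' t ht hrt
    have hJ' : J'.card = n := card_eq_of_coe_eq_range ht hrt
    have h := stub_transport (MvPolynomial (Fin n × Fin m') ℂ) n (Fin (n + m')) M t ⇑(J'.orderEmbOfFin hJ') ht
      (J'.orderEmbOfFin hJ').injective (by rw [Finset.range_orderEmbOfFin, hrt])
    obtain ⟨ε, -, -, h2⟩ := exists_smul_of_eq_or_eq_neg (K := FractionRing (MvPolynomial (Fin n × Fin m') ℂ)) h
    exact ⟨ε, by rw [hP J' hJ']; exact h2⟩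
  -- (i) summands whose new column lies in `J − p − Q` vanish
  have hzero : ∀ t : Fin n, e' t ∉ U →
      φ (M.submatrix id (Function.update e a (e' t))).det *
        φ (M.submatrix id (Function.update e' t (e a))).det = 0 := by
    intro t ht
    have htK : e' t ∈ K := by rw [← Finset.mem_coe, ← hre']; exact ⟨t, rfl⟩
    have htJ : e' t ∈ J ∧ e' t ≠ p := by
      rcases (hmemK _).1 htK with ⟨h1, h2, -⟩ | h
      · exact ⟨h1, h2⟩
      · exact absurd h ht
    obtain ⟨c, hc⟩ : e' t ∈ Set.range e := by rw [hre]; exact htJ.1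
    have hca : c ≠ a := fun h => htJ.2 (by rw [← hc, h, ha])
    rw [← hc, det_submatrix_update_self_eq_zero M e hca, map_zero, zero_mul]
  -- (ii) summands with new column `u = e' t ∈ U` are `±` the displayed products
  have hprod : ∀ t : Fin n, ∃ c : ℂ, e' t ∈ U →
      φ (M.submatrix id (Function.update e a (e' t))).det *
          φ (M.submatrix id (Function.update e' t (e a))).det =
        c • (P (insert (e' t) (J.erase p)) * P (((J \ Q) ∪ U).erase (e' t))) := by
    intro t
    by_cases htU : e' t ∈ U
    · have huJ : e' t ∉ Set.range e := by rw [hre]; exact hU _ htU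
      have hi₁ : Function.Injective (Function.update e a (e' t)) := update_injective_of_notMem he a huJ
      have hr₁ : (↑(insert (e' t) (J.erase p)) : Set (Fin (n + m'))) =
          Set.range (Function.update e a (e' t)) := by
        rw [range_update_of_injective he, Finset.coe_insert, Finset.coe_erase, hre, ha]
      have hpK' : e a ∉ Set.range e' := by rw [ha, hre']; exact hpK
      have hi₂ : Function.Injective (Function.update e' t (e a)) := update_injective_of_notMem he' t hpK'
      have hr₂ : (↑(((J \ Q) ∪ U).erase (e' t)) : Set (Fin (n + m'))) =
          Set.range (Function.update e' t (e a)) := by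
        rw [range_update_of_injective he', ha, hre']
        ext x
        simp only [Finset.coe_erase, Finset.coe_union, Finset.coe_sdiff, Set.mem_sdiff, Set.mem_union,
          Finset.mem_coe, Set.mem_singleton_iff, Set.mem_insert_iff, hmemK]
        constructor
        · rintro ⟨h | h, hne⟩
          · by_cases hxp : x = p
            · exact Or.inl hxp
            · exact Or.inr ⟨Or.inl ⟨h.1, hxp, h.2⟩, hne⟩
          · exact Or.inr ⟨Or.inr h, hne⟩
        · rintro (rfl | ⟨⟨h1, -, h3⟩ | h, hne⟩)
          · exact ⟨Or.inl ⟨hp, hpQ⟩, fun h => hU _ htU (h ▸ hp)⟩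
          · exact ⟨Or.inl ⟨h1, h3⟩, hne⟩
          · exact ⟨Or.inr h, hne⟩
      obtain ⟨α, hα⟩ := transport _ _ hi₁ hr₁
      obtain ⟨β, hβ⟩ := transport _ _ hi₂ hr₂
      refine ⟨α * β, fun _ => ?_⟩
      rw [hα, hβ, smul_mul_smul_comm]
    · exact ⟨0, fun h => absurd h htU⟩
  choose c hc using hprod
  -- regroup the sum over positions `t` as a sum over `u = e' t ∈ U`
  refine ⟨fun u => ∑ t ∈ (Finset.univ.filter fun t : Fin n => e' t ∈ U).filter (fun t => e' t = u), c t, ?_⟩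
  have hPJ : P J = φ (M.submatrix id e).det := hP J hJ
  have hPK : P K = φ (M.submatrix id e').det := hP K hKc
  have hid := congrArg φ (det_mul_det_eq_sum_update M e e' a)
  rw [map_mul, map_sum] at hid
  rw [hPJ, hPK, hid]
  have step1 : ∑ t, φ ((M.submatrix id (Function.update e a (e' t))).det *
      (M.submatrix id (Function.update e' t (e a))).det) =
      ∑ t ∈ Finset.univ.filter (fun t : Fin n => e' t ∈ U),
        c t • (P (insert (e' t) (J.erase p)) * P (((J \ Q) ∪ U).erase (e' t))) := by
    rw [← Finset.sum_subset (Finset.filter_subset (fun t : Fin n => e' t ∈ U) Finset.univ)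
      (fun t _ ht => by
        rw [map_mul]
        exact hzero t (by simpa using ht))]
    refine Finset.sum_congr rfl fun t ht => ?_
    rw [map_mul]
    exact hc t (by simpa using ht)
  rw [step1, ← Finset.sum_fiberwise_of_maps_to (g := e') (t := U) (fun t ht => by simpa using ht)]
  refine Finset.sum_congr rfl fun u _ => ?_
  rw [Finset.sum_smul]
  refine Finset.sum_congr rfl fun t ht => ?_
  rw [(Finset.mem_filter.1 ht).2]

end Summit.MatrixMultiplication.MatrixMultiplication.Theorems.LongExchangeSound
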